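import Mathlib.Data.ZMod.Basic
import Mathlib.Data.Nat.Factorial.Basic
import Mathlib.Tactic.LinearCombination
import Mathlib.Tactic.FieldSimp
import Mathlib.Tactic.Ring
import Mathlib.Tactic.NormNum
import Mathlib.Tactic.Linarith
import Summits.HodgeConjecture.HodgeConjecture.Theorems.Ring2AbelianAllNonsplitNormObstruction
import HarnessLib

/-!
# NSC(−2) seed census II (report `NSC-SEEDS-2.md`, prover 1 gen 58): the arithmetic behind the B_b port, the stations table and the
# transport theorem — five def-free heads

Family `hodge`, b2b cell `hweil` (helper of item stmt-HodgeConjecture-2524; cell target NSC(−2) =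
`Ring2.Hypotheses.WeilClassesComponent 3 3 [−2]`, fed by `Ring2.AbelianAll.HasBlochSeedInClass 3 3 [−2]` /
`Ring2.AbelianAll.HasLocallyAlgebraicWeilAnchorInClass 3 3 [−2]`). Report
`run/shared/lean/b2b/hodge-weil/b2b-hweil-pv1-g58/NSC-SEEDS-2.md` (orders LADDER `## CARVER v133` C811 (e)(i), `## CARVER v134` C815 (e)(i)).
Only what is stated below is formalised; the geometric statements are the report's (seat level):

* `nsc2_F18_eigenspace_sums` — B_b PORT (report §1): for the `ℤ/18`-cover `y¹⁸ = (x−b₁)(x−b₂)⁴(x−b₃)⁴(x−b₄)⁹` (branch data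
  `a = (1,4,4,9)`) and `j ∈ (ℤ/18)ˣ = {1,5,7,11,13,17}` the sums `Σᵢ (j·aᵢ mod 18)` are `18, 18, 36, 36, 54, 54`; by the Chevalley–Weil /
  Hurwitz formula `n_j = Σᵢ ⟨j aᵢ/18⟩ − 1` the eigenspace multiplicities of the automorphism on `H^{1,0}` of the Prym `B_b = ker⁰Φ₁₈(s)` are
  `(n₁,n₅,n₇,n₁₁,n₁₃,n₁₇) = (0,0,1,1,2,2)`: CM type of `ℚ(ζ₉)` with pairs `(0,2),(0,2),(1,1)`, `(3,3)` Weil type over `ℚ(√−3)`, ONE modulus, and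
  — the point used — every Mumford index on `NS(B_b)_ℚ = c_h(ℚ(ζ₉)⁺)` is EVEN (`2·#{τ : τ(f) < 0}`), so `Ext¹ = Ext³ = Ext⁵ = 0` across `NS(B_b)`.
* `nsc2_sq_eq_two_norm` — STATIONS (report §2.1): `j² = 2(a² + 3b²)` has only the zero solution in integers (`(2a)² + 3(2b)² = 2j²` and
  ring-2's `int_eq_zero_of_sq_add_three_sq_eq_two_sq`): the Euler characteristic `χ(L_{jh + v(λ)}) = 2(j² − 2N(λ))³` of a class of the
  type-II lattice `ℤh ⊕ 𝒪_K·b` at `P₀` never vanishes, i.e. the INDEX TRICHOTOMY `{0,3,6}` of C811 (c) holds on the INTEGRAL lattice with no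
  degenerate class: the constituents of every hexagon design meet only through `Hom`, `Ext³`, `Ext⁶`.
* `nsc2_typeII_euler_char_ne_zero` — the same, as the non-vanishing of `2(j² − 2(a² + 3b²))³` for `(j,a,b) ≠ 0`.
* `nsc2_gaussian_of_recurrence` — THEOREM TWIST (report §3), necessity half: if the coefficients of `P(h) = Σ p_k h^k` satisfy
  `k·p_k = t·p_{k−1}` for `1 ≤ k ≤ K` then `p_k = p₀ t^k / k!` for `k ≤ K` — the polynomial part of the Chern character of an object that
  becomes an anchor for a SECOND polarisation `t h + u` after a twist by a `K`-symmetric line bundle `L_u`, `u ∉ ℚh`, is GAUSSIAN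
  (`ch = r·exp(t h) + w`, `w` a Weil class) up to the top degree.
* `nsc2_index_chain` — INDEX–DEGREE LEMMA (report §2.2), bookkeeping half: for a closed chain of non-degenerate line bundles on an abelian
  `g`-fold the last index is `g − I` with `I ≤ Σ` (subadditivity of the index, proved in the report), hence the indices sum to `≥ g`:
  every Yoneda cycle through non-degenerate stations has degree `≥ g` (= 6 > 2 at `P₀`).

* ADDENDUM 1 (`section NscSeedsTwoAddendum`, report §9): `nsc2_discriminant_of_extension` (the Bogomolov-discriminant identity
  `Δ(F₁ ⊕ F₂) = (r₁+r₂)(Δ₁/r₁ + Δ₂/r₂) − r₁r₂(μ₁ − μ₂)²` behind PROPOSITION NOSTAB: a μ-semistable torsion-free sheaf whose Chern character is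
  Gaussian in degrees ≤ 2 and Gaussian + Weil in degree 3 has Weil part 0) and `nsc2_chern_of_projectively_flat` (the `[m]`-pull-back
  bookkeeping `m^{2k} ch_k = r (m²c₁/r)^k/k! ⟹ ch_k = r (c₁/r)^k/k!`: a projectively flat bundle on an abelian variety has `ch = r·exp(c₁/r)`).

HONEST FRAMING: census / obstruction work for the seed and anchor objects of ONE cell; nothing here is a rung; no case of the Hodge conjecture
is proved or claimed; no statement of [Markman 2025] / [Perry 2026] is used. [cite: vanGeemen1994HodgeAV, 4.14 and (5.4.1)]
[cite: Bloch1972Semiregularity, Remark (7.5)]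
-/

-- mandated namespace `Summit.HodgeConjecture.HodgeConjecture.…` (Problem = Summit) trips `linter.dupNamespace`; the lakefile disables it
-- tree-wide (weak option), restated here so stand-alone elaboration is warning-free too.
set_option linter.dupNamespace false

namespace Summit.HodgeConjecture.HodgeConjecture.WeilTypeLadder

section NscSeedsTwo

/-- **NSC-SEEDS-2 §1 (B_b port): the Chevalley–Weil sums of the `ℤ/18`-cover `y¹⁸ = (x−b₁)(x−b₂)⁴(x−b₃)⁴(x−b₄)⁹`.**  For the six units
`j ∈ {1,5,7,11,13,17}` of `ℤ/18` and the branch data `a = (1,4,4,9)` (with `Σ aᵢ = 18`), `Σᵢ (j·aᵢ mod 18) = 18·(n_j + 1)` with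
`(n_j) = (0,0,1,1,2,2)` — the multiplicities of the primitive eigenvalues `ζ₁₈^j` on `H^{1,0}` of the curve, i.e. the CM type of `ℚ(ζ₉)` acting on the
six-dimensional Prym `B_b`: pairs `(n_j, n_{−j}) = (0,2), (0,2), (1,1)`; over the two embeddings of `ℚ(√−3) = ℚ(ζ₁₈⁶)` (`j ≡ 1` resp. `5 (mod 6)`)
the multiplicities add up to `3` and `3` (Weil type `(3,3)`); `Σ n_j n_{−j} = 1` modulus.  Consequently the Mumford index of `c_h(f)`, `f` totally
real in `ℚ(ζ₉)⁺`, is `Σ_{τ(f)<0} (n_j + n_{−j}) = 2·#{τ : τ(f) < 0} ∈ {0,2,4,6}` (report §1.2). [`decide`] [folklore: Chevalley–Weil] -/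
theorem nsc2_F18_eigenspace_sums :
    ((1 * 1 % 18 + 1 * 4 % 18 + 1 * 4 % 18 + 1 * 9 % 18 = 18 * (0 + 1)) ∧
     (5 * 1 % 18 + 5 * 4 % 18 + 5 * 4 % 18 + 5 * 9 % 18 = 18 * (0 + 1)) ∧
     (7 * 1 % 18 + 7 * 4 % 18 + 7 * 4 % 18 + 7 * 9 % 18 = 18 * (1 + 1)) ∧
     (11 * 1 % 18 + 11 * 4 % 18 + 11 * 4 % 18 + 11 * 9 % 18 = 18 * (1 + 1)) ∧
     (13 * 1 % 18 + 13 * 4 % 18 + 13 * 4 % 18 + 13 * 9 % 18 = 18 * (2 + 1)) ∧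
     (17 * 1 % 18 + 17 * 4 % 18 + 17 * 4 % 18 + 17 * 9 % 18 = 18 * (2 + 1))) ∧
    -- Weil signature over the two embeddings of ℚ(√−3), one modulus, and every pair sum n_j + n_{−j} = 2 (so indices are even)
    ((0 + 1 + 2 = 3 ∧ 0 + 1 + 2 = 3) ∧ (0 * 2 + 0 * 2 + 1 * 1 = 1) ∧ (0 + 2 = 2 ∧ 0 + 2 = 2 ∧ 1 + 1 = 2)) := by
  decide

/-- **NSC-SEEDS-2 §2.1 (stations; the index trichotomy on the integral type-II lattice).**  `j² = 2(a² + 3b²)` — i.e. `j² = 2·N(a + b√−3)` —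
forces `j = a = b = 0`: multiply by `2` to get `(2a)² + 3(2b)² = 2j²` and apply ring-2's descent
`int_eq_zero_of_sq_add_three_sq_eq_two_sq`.  In the report: the hermitian matrix of the class `j h + v(λ)` (`h` of weights `(2,1,1,1,1,1)`,
`v(λ)` a `K`-multiple of `b = c_h(β)`) is congruent to `diag(jD, ((j² − 2N(λ))/j)·I₃)`, so its determinant `2(j² − 2N(λ))³` vanishes for no
`(j, λ) ≠ 0` and its index is `0`, `3` or `6`. [cite: vanGeemen1994HodgeAV, (5.4.1)] -/
theorem nsc2_sq_eq_two_norm (j a b : ℤ) (h : j ^ 2 = 2 * (a ^ 2 + 3 * b ^ 2)) : j = 0 ∧ a = 0 ∧ b = 0 := by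
  have key : (2 * a) ^ 2 + 3 * (2 * b) ^ 2 = 2 * j ^ 2 := by linear_combination (-2 : ℤ) * h
  obtain ⟨ha, hb, hj⟩ :=
    Summit.HodgeConjecture.Ring2AbelianAll.NonsplitNormObstruction.int_eq_zero_of_sq_add_three_sq_eq_two_sq (2 * a) (2 * b) j key
  refine ⟨hj, ?_, ?_⟩ <;> omega

/-- **NSC-SEEDS-2 §2.1 (the Euler characteristic on the type-II lattice never vanishes).**  For integers `(j, a, b) ≠ (0,0,0)`,
`2·(j² − 2(a² + 3b²))³ ≠ 0`: every class `j h + v(λ)`, `λ = a + b√−3 ∈ 𝒪_K`, of the lattice `ℤh ⊕ 𝒪_K b ⊂ NS(P₀)` is NON-DEGENERATE with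
`χ = 2(j² − 2N(λ))³` (report §2.1, STATIONS I; machine table `code/pv1-g58/nsc2.py stations`). [`nsc2_sq_eq_two_norm`] -/
theorem nsc2_typeII_euler_char_ne_zero (j a b : ℤ) (hne : ¬ (j = 0 ∧ a = 0 ∧ b = 0)) :
    2 * (j ^ 2 - 2 * (a ^ 2 + 3 * b ^ 2)) ^ 3 ≠ 0 := by
  intro h0
  have h1 : (j ^ 2 - 2 * (a ^ 2 + 3 * b ^ 2)) ^ 3 = 0 := by
    have := mul_eq_zero.mp h0
    rcases this with h2 | h3
    · norm_num at h2
    · exact h3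
  have h2 : j ^ 2 - 2 * (a ^ 2 + 3 * b ^ 2) = 0 := pow_eq_zero_iff (n := 3) (by norm_num) |>.mp h1
  exact hne (nsc2_sq_eq_two_norm j a b (by linear_combination h2))

/-- **NSC-SEEDS-2 §3 (THEOREM TWIST, necessity half: the polynomial part is Gaussian).**  If `p : ℕ → F` satisfies the first-order
recurrence `(k+1)·p (k+1) = t·p k` for all `k < K` — in the report: the vanishing, degree by degree, of the contraction
`ξ ⌟ (e^u·Σ p_k h^k) = e^u (ξ ⌟ h) Σ_k (k p_k − t p_{k−1}) h^{k−1}` along the directions that fix `t h + u` but move `h` — then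
`p k · k! = p 0 · t^k` for all `k ≤ K`: `Σ p_k h^k = p₀·exp(t h)` up to the top degree.  So an object that anchors a SECOND Weil family after a
twist by a `K`-symmetric line bundle has Chern character `r·exp(t h) + w`. [elementary induction] -/
theorem nsc2_gaussian_of_recurrence {F : Type*} [Field F] [CharZero F] (p : ℕ → F) (t : F) (K : ℕ)
    (hrec : ∀ k, k < K → ((k : F) + 1) * p (k + 1) = t * p k) :
    ∀ k, k ≤ K → p k * (k.factorial : F) = p 0 * t ^ k := by
  intro k
  induction k with
  | zero => intro _; simp
  | succ n ih =>
    intro hn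
    have hn' : n < K := Nat.lt_of_succ_le hn
    have ih' := ih (le_of_lt hn')
    have hr := hrec n hn'
    rw [Nat.factorial_succ, Nat.cast_mul, pow_succ]
    calc p (n + 1) * (((n + 1 : ℕ) : F) * (n.factorial : F))
        = (((n : F) + 1) * p (n + 1)) * (n.factorial : F) := by push_cast; ring
      _ = (t * p n) * (n.factorial : F) := by rw [hr]
      _ = t * (p n * (n.factorial : F)) := by ring
      _ = t * (p 0 * t ^ n) := by rw [ih']
      _ = p 0 * (t ^ n * t) := by ring

/-- **NSC-SEEDS-2 §2.2 (INDEX–DEGREE LEMMA, bookkeeping half).**  On an abelian `g`-fold, a closed chain of non-degenerate line bundles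
`N₁, …, N_m, N_{m+1}` with `N₁ ⊗ ⋯ ⊗ N_{m+1} ≅ 𝒪` has `i(N_{m+1}) = g − i(N₁ ⊗ ⋯ ⊗ N_m)` (Mumford: `i(N⁻¹) = g − i(N)`) and
`i(N₁ ⊗ ⋯ ⊗ N_m) ≤ Σ_{k ≤ m} i(N_k)` (subadditivity of the number of negative eigenvalues of a sum of hermitian forms, report §2.2); this head
records the consequence `Σ_{k ≤ m+1} i(N_k) ≥ g`: every Yoneda cycle `L → L⊗N₁[i₁] → ⋯ → L[Σ i_k]` through non-degenerate stations has degree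
`≥ g` — for `g = 6` no station feeds the obstruction group `Ext²(L, L)`. [`omega`] -/
theorem nsc2_index_chain (g S I : ℕ) (hI : I ≤ S) (hIg : I ≤ g) : g ≤ S + (g - I) := by
  omega

end NscSeedsTwo

section NscSeedsTwoAddendum

/-- **NSC-SEEDS-2 ADDENDUM 1, PROPOSITION NOSTAB (algebraic core: the discriminant of an extension).**  For two torsion-free sheaves (or Chern
data) of ranks `r₁, r₂ ≠ 0`, first Chern classes `a₁, a₂` and second Chern characters `c₁, c₂` (all read as numbers after pairing with a fixed
class), with `Δ_i := a_i² − 2 r_i c_i` and `Δ := (a₁ + a₂)² − 2(r₁ + r₂)(c₁ + c₂)` the discriminant of the extension / direct sum: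
`Δ = (r₁ + r₂)(Δ₁/r₁ + Δ₂/r₂) − r₁ r₂ (a₁/r₁ − a₂/r₂)²`.  In the report: with Bogomolov (`Δ_i·H⁴ ≥ 0` for semistable factors) and Hodge index
(`(μ₁ − μ₂)²·H⁴ ≤ 0` for slopes with `(μ₁ − μ₂)·H⁵ = 0`) this forces, when `Δ·H⁴ = 0`, equal slopes and `Δ_i·H⁴ = 0` for every Jordan–Hölder factor,
whence projective flatness and `ch = r·exp(c₁/r)` — no Weil part. [`field_simp`, `ring`] -/
theorem nsc2_discriminant_of_extension {F : Type*} [Field F] (r₁ r₂ a₁ a₂ c₁ c₂ : F) (h₁ : r₁ ≠ 0) (h₂ : r₂ ≠ 0) :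
    (a₁ + a₂) ^ 2 - 2 * (r₁ + r₂) * (c₁ + c₂) =
      (r₁ + r₂) * ((a₁ ^ 2 - 2 * r₁ * c₁) / r₁ + (a₂ ^ 2 - 2 * r₂ * c₂) / r₂) - r₁ * r₂ * (a₁ / r₁ - a₂ / r₂) ^ 2 := by
  field_simp
  ring

/-- **NSC-SEEDS-2 ADDENDUM 1, PROPOSITION NOSTAB (algebraic core: Chern character of a projectively flat bundle on an abelian variety).**
If `E` of rank `r` is projectively flat, the pull-back by multiplication by `m` (with `r ∣ m²`) is `F ⊗ L` with `F` flat, so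
`[m]^* ch_k(E) = m^{2k}·ch_k(E)` equals `r·c₁(L)^k/k!` with `c₁(L) = m²·c₁(E)/r`; this head cancels the `m^{2k}`:
`m^{2k}·x = r·(m²c/r)^k/k!` with `m ≠ 0` gives `x = r·(c/r)^k/k!`, i.e. `ch(E) = r·exp(c₁(E)/r)` EXACTLY (no component outside the exponential,
in particular no Weil part). [elementary] -/
theorem nsc2_chern_of_projectively_flat {F : Type*} [Field F] (m r c x : F) (k : ℕ) (hm : m ≠ 0)
    (h : m ^ (2 * k) * x = r * (m ^ 2 * c / r) ^ k / (k.factorial : F)) :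
    x = r * (c / r) ^ k / (k.factorial : F) := by
  have hpow : (m ^ 2 * c / r) ^ k = m ^ (2 * k) * (c / r) ^ k := by
    rw [show m ^ 2 * c / r = m ^ 2 * (c / r) by ring, mul_pow, ← pow_mul]
  rw [hpow] at h
  have hm2 : m ^ (2 * k) ≠ 0 := pow_ne_zero _ hm
  have h' : m ^ (2 * k) * x = m ^ (2 * k) * (r * (c / r) ^ k / (k.factorial : F)) := by
    rw [h]; ring
  exact mul_left_cancel₀ hm2 h'

end NscSeedsTwoAddendum

end Summit.HodgeConjecture.HodgeConjecture.WeilTypeLadder
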